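import Summits.AtomisticToContinuum.FouriersLaw.Theorems.VanishingNoiseTransferNoisyFourierOfResistanceGluing

/-!
# `NoisyFourier`: the open core in its weakest importable forms (line `sector-dirichlet-gluing`, cycle c3)

Crux `VanishingNoiseTransfer.NoisyFourier` (stmt-AtomisticToContinuum-11977). After cycles c0–c2 the whole
fixed-`N` flip theory of the line is LANDED (clause (i) `∃!`, the response coefficients `D_N(ε)`, their
positivity for `N ≥ 2`, the Fourier-type ceiling `D_N ≤ K`), and `noisyFourier_of_resistanceGluing` (p124321)
reduces the crux to the series law `R_{N+M} ≤ R_N + R_M + C` for `R_N = (N−1)/D_N` (the Thomson side of the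
card). This file records, sorry-free and importable, the THREE OTHER shapes in which the remaining `N → ∞`
content closes the crux, so that whichever is proved first finishes it by one `exact`:

* `noisyFourier_of_responseLimit` — the minimal form: along every flip-steady family the response
  sequence converges to a positive limit (this is clause (ii) minus the landed fixed-`N` theory; no Fekete).
* `noisyFourier_of_monotoneResponse` — EVENTUAL MONOTONICITY `D_N ≤ D_{N+1}` (`N ≥ N₀ ≥ 2`) suffices: with the
  landed ceiling the sequence converges, and the limit is `≥ D_{N₀} > 0` by the landed positivity
  (`tendsto_pos_of_monotone_of_bdd`). Numerically `D_N` is increasing from small `N` on in every regime tested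
  (item evidence RESULTS_A.md; DrefuteNotes.md records small-`N` non-monotonicity only at `ε = 2`).
* `noisyFourier_of_superadditiveResistance_of_floor` — the DUAL series law (Dirichlet side, the side on
  which the ceiling was provable by entropy production): `R_N + R_M ≤ R_{N+M} + C` together with an
  `N`-uniform conductance FLOOR `d ≤ D_N` gives `D_N → 1/ℓ > 0` (`tendsto_pos_of_superGluing_of_floor_of_bdd`:
  Fekete for the subadditive sequence `C − R_N`, the floor bounds `R_N/N` above, the ceiling keeps `ℓ ≥ 1/K`).

No definitions; no sorry; every theorem is an implication (the crux itself stays open).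
-/

noncomputable section

namespace Summit.AtomisticToContinuum.FouriersLaw.Theorems.NoisyFourier.LineAssembly

open Filter Topology MeasureTheory
open Literature.MathematicalPhysics.KineticTheory.HeatConduction
open Summit.AtomisticToContinuum.FouriersLaw.Cruxes.NoisyFourier

/-! ## Real analysis: two more ways a positive bounded response sequence converges -/

/-- **Eventually monotone + ceiling ⇒ positive limit.** If `D_N ≤ D_{N+1}` for `N ≥ N₀` (`N₀ ≥ 2`),
`D_N ≤ K` for `N ≥ 2` and `0 < D_{N₀}`, then `D_N → s` for some `s > 0` (the supremum over `N ≥ N₀`). [folklore] -/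
theorem tendsto_pos_of_monotone_of_bdd {D : ℕ → ℝ} {N₀ : ℕ} (hN₀ : 2 ≤ N₀)
    (hmono : ∀ N : ℕ, N₀ ≤ N → D N ≤ D (N + 1)) {K : ℝ} (hbdd : ∀ N : ℕ, 2 ≤ N → D N ≤ K)
    (h0 : 0 < D N₀) :
    ∃ s : ℝ, 0 < s ∧ Tendsto D atTop (𝓝 s) := by
  set E : ℕ → ℝ := fun n => D (n + N₀) with hE
  have hEmono : Monotone E := by
    refine monotone_nat_of_le_succ fun n => ?_
    simp only [hE]
    have := hmono (n + N₀) (by omega)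
    simpa [add_assoc, add_comm, add_left_comm] using this
  have hEbdd : BddAbove (Set.range E) :=
    ⟨K, by rintro _ ⟨n, rfl⟩; exact hbdd (n + N₀) (by omega)⟩
  have hElim : Tendsto E atTop (𝓝 (⨆ n, E n)) := tendsto_atTop_ciSup hEmono hEbdd
  refine ⟨⨆ n, E n, ?_, ?_⟩
  · exact lt_of_lt_of_le (by simpa [hE] using h0) (le_ciSup hEbdd 0)
  · exact (tendsto_add_atTop_iff_nat N₀).1 hElim

/-- **Dual series law + floor + ceiling ⇒ positive limit.** If `0 < d ≤ D_N ≤ K` for `N ≥ 2` and the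
resistances `R_N = (N−1)/D_N` are quasi-SUPERadditive on `{N ≥ 2}` (`R_N + R_M ≤ R_{N+M} + C`), then
`D_N → s > 0`: `C − R_N` is subadditive with `(C − R_N)/N ≥ −1/d`, so Fekete (`Drefute.fekete_Ici_two`) gives
`R_N/N → ℓ`; the ceiling gives `ℓ ≥ 1/K > 0`; and `D_N = ((N−1)/N)/(R_N/N) → 1/ℓ`. [folklore] -/
theorem tendsto_pos_of_superGluing_of_floor_of_bdd {D : ℕ → ℝ} {d : ℝ} (hd : 0 < d)
    (hfloor : ∀ N : ℕ, 2 ≤ N → d ≤ D N) {K : ℝ} (hbdd : ∀ N : ℕ, 2 ≤ N → D N ≤ K) {C : ℝ}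
    (hR : ∀ N M : ℕ, 2 ≤ N → 2 ≤ M →
      ((N : ℝ) - 1) / D N + ((M : ℝ) - 1) / D M ≤ (((N + M : ℕ) : ℝ) - 1) / D (N + M) + C) :
    ∃ s : ℝ, 0 < s ∧ Tendsto D atTop (𝓝 s) := by
  have hpos : ∀ N : ℕ, 2 ≤ N → 0 < D N := fun N hN => hd.trans_le (hfloor N hN)
  set r : ℕ → ℝ := fun n => ((n : ℝ) - 1) / D n with hr
  set b : ℕ → ℝ := fun n => C - r n with hb
  have hsub : ∀ n m : ℕ, 2 ≤ n → 2 ≤ m → b (n + m) ≤ b n + b m := by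
    intro n m hn hm
    have := hR n m hn hm
    simp only [hb, hr] at this ⊢
    linarith
  -- lower bound: b n / n ≥ -(1/d), since r n ≤ (n-1)/d ≤ n/d and C/n ≥ -|C|/... we use C/n ≥ -|C|
  have hlow : ∀ n : ℕ, 2 ≤ n → -|C| - 1 / d ≤ b n / n := by
    intro n hn
    have hn1 : (1 : ℝ) ≤ n := by exact_mod_cast (show 1 ≤ n by omega)
    have hnpos : (0 : ℝ) < n := by linarith
    have hDn := hpos n hn
    have hfl := hfloor n hn
    -- r n ≤ n / d
    have hrle : r n ≤ (n : ℝ) / d := by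
      simp only [hr]
      rw [div_le_div_iff₀ hDn hd]
      nlinarith
    have h1 : -|C| ≤ C / n := by
      rw [le_div_iff₀ hnpos]
      nlinarith [neg_abs_le C, abs_nonneg C]
    have h2 : -(1 / d) ≤ -(r n / n) := by
      rw [neg_le_neg_iff, div_le_iff₀ hnpos]
      calc r n ≤ (n : ℝ) / d := hrle
        _ = 1 / d * n := by ring
    have h3 : b n / n = C / n - r n / n := by simp only [hb]; ring
    rw [h3]
    linarith
  obtain ⟨L, hL⟩ := Drefute.fekete_Ici_two hsub hlow
  -- r n / n → C·0 - L =: ℓ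
  have hC : Tendsto (fun n : ℕ => C / (n : ℝ)) atTop (𝓝 0) :=
    tendsto_const_nhds.div_atTop tendsto_natCast_atTop_atTop
  have hrlim : Tendsto (fun n : ℕ => r n / n) atTop (𝓝 (0 - L)) := by
    refine (hC.sub hL).congr' ?_
    filter_upwards [eventually_ge_atTop 1] with n hn
    simp only [hb]
    ring
  rw [zero_sub] at hrlim
  set ℓ : ℝ := -L with hℓ
  have hK : 0 < K := (hpos 2 le_rfl).trans_le (hbdd 2 le_rfl)
  -- lower bound r n / n ≥ ((n-1)/n) / K, whose limit is 1/K
  have hlow' : ∀ᶠ n : ℕ in atTop, ((n : ℝ) - 1) / n / K ≤ r n / n := by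
    filter_upwards [eventually_ge_atTop 2] with n hn
    have hn2 : (2 : ℝ) ≤ n := by exact_mod_cast hn
    have hnpos : (0 : ℝ) < n := by linarith
    have hD := hpos n hn
    have hDK := hbdd n hn
    simp only [hr]
    rw [div_div, div_div]
    apply div_le_div_of_nonneg_left (by linarith) (by positivity) ?_
    nlinarith
  have h1 : Tendsto (fun n : ℕ => ((n : ℝ) - 1) / n) atTop (𝓝 1) := by
    have h : Tendsto (fun N : ℕ => (1 : ℝ) - 1 / (N : ℝ)) atTop (𝓝 (1 - 0)) :=
      tendsto_const_nhds.sub tendsto_one_div_atTop_nhds_zero_nat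
    rw [sub_zero] at h
    refine h.congr' ?_
    filter_upwards [eventually_ge_atTop 1] with N hN
    have hN : (0 : ℝ) < N := by exact_mod_cast hN
    field_simp
  have hlim : Tendsto (fun n : ℕ => ((n : ℝ) - 1) / n / K) atTop (𝓝 (1 / K)) := by
    simpa using h1.div_const K
  have hℓK : 1 / K ≤ ℓ := le_of_tendsto_of_tendsto hlim hrlim hlow'
  have hℓpos : 0 < ℓ := lt_of_lt_of_le (by positivity) hℓK
  refine ⟨1 / ℓ, by positivity, ?_⟩
  have h2 : Tendsto (fun n : ℕ => ((n : ℝ) - 1) / n / (r n / n)) atTop (𝓝 (1 / ℓ)) :=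
    h1.div hrlim hℓpos.ne'
  refine h2.congr' ?_
  filter_upwards [eventually_ge_atTop 2] with n hn
  have hn2 : (2 : ℝ) ≤ n := by exact_mod_cast hn
  have hn0 : (n : ℝ) ≠ 0 := by positivity
  have hn1 : (n : ℝ) - 1 ≠ 0 := by linarith
  have hD : D n ≠ 0 := (hpos n hn).ne'
  simp only [hr]
  field_simp

/-! ## The crux from a positive response limit (the minimal form) -/

/-- **`FlipFouriersLawFor` from clause (i), the fixed-`N` response, and a positive response limit along
every flip-steady family** (sorry-free composition; the limit hypothesis is used only along the canonical
family, uniqueness transfers clause (ii) to every family via `flipFouriersLawFor_of_canonical`). -/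
theorem flipFouriersLawFor_of_responseLimit
    (hEU : (∀ ω₂ lam β γ : ℝ, 0 < ω₂ → 0 < lam → 0 < β → 0 < γ → ∀ ε : ℝ, 0 < ε →
      ∀ (N : ℕ) (T_L T_R : ℝ), 0 < T_L → 0 < T_R →
        ∃ μ : MeasureTheory.Measure
            (Literature.MathematicalPhysics.KineticTheory.HeatConduction.PhaseSpace N),
          (Literature.MathematicalPhysics.KineticTheory.HeatConduction.pinnedChain
              ω₂ lam β γ).IsFlipSteadyState N T_L T_R ε μ ∧
          ∀ ν : MeasureTheory.Measure
              (Literature.MathematicalPhysics.KineticTheory.HeatConduction.PhaseSpace N),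
            (Literature.MathematicalPhysics.KineticTheory.HeatConduction.pinnedChain
                ω₂ lam β γ).IsFlipSteadyState N T_L T_R ε ν → ν = μ))
    (hFR : (∀ ω₂ lam β γ : ℝ, 0 < ω₂ → 0 < lam → 0 < β → 0 < γ → ∀ ε : ℝ, 0 < ε →
      (∀ (N : ℕ) (T_L T_R : ℝ), 0 < T_L → 0 < T_R →
        ∀ μ ν : MeasureTheory.Measure
            (Literature.MathematicalPhysics.KineticTheory.HeatConduction.PhaseSpace N),
          (Literature.MathematicalPhysics.KineticTheory.HeatConduction.pinnedChain
              ω₂ lam β γ).IsFlipSteadyState N T_L T_R ε μ →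
          (Literature.MathematicalPhysics.KineticTheory.HeatConduction.pinnedChain
              ω₂ lam β γ).IsFlipSteadyState N T_L T_R ε ν → μ = ν) →
      ∀ μ : (N : ℕ) → ℝ → ℝ → MeasureTheory.Measure
          (Literature.MathematicalPhysics.KineticTheory.HeatConduction.PhaseSpace N),
        (∀ (N : ℕ) (T_L T_R : ℝ), 0 < T_L → 0 < T_R →
          (Literature.MathematicalPhysics.KineticTheory.HeatConduction.pinnedChain
              ω₂ lam β γ).IsFlipSteadyState N T_L T_R ε (μ N T_L T_R)) →
        ∀ T : ℝ, 0 < T → ∀ N : ℕ, ∃ D : ℝ,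
          Filter.Tendsto (fun δ : ℝ =>
            (Literature.MathematicalPhysics.KineticTheory.HeatConduction.pinnedChain
                ω₂ lam β γ).totalCurrent (μ N (T + δ / 2) (T - δ / 2)) / δ)
            (nhdsWithin 0 {(0 : ℝ)}ᶜ) (nhds D)))
    (hL : (∀ ω₂ lam β γ : ℝ, 0 < ω₂ → 0 < lam → 0 < β → 0 < γ → ∀ ε : ℝ, 0 < ε →
      (∀ (N : ℕ) (T_L T_R : ℝ), 0 < T_L → 0 < T_R →
        ∀ μ ν : MeasureTheory.Measure
            (Literature.MathematicalPhysics.KineticTheory.HeatConduction.PhaseSpace N),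
          (Literature.MathematicalPhysics.KineticTheory.HeatConduction.pinnedChain
              ω₂ lam β γ).IsFlipSteadyState N T_L T_R ε μ →
          (Literature.MathematicalPhysics.KineticTheory.HeatConduction.pinnedChain
              ω₂ lam β γ).IsFlipSteadyState N T_L T_R ε ν → μ = ν) →
      ∀ μ : (N : ℕ) → ℝ → ℝ → MeasureTheory.Measure
          (Literature.MathematicalPhysics.KineticTheory.HeatConduction.PhaseSpace N),
        (∀ (N : ℕ) (T_L T_R : ℝ), 0 < T_L → 0 < T_R →
          (Literature.MathematicalPhysics.KineticTheory.HeatConduction.pinnedChain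
              ω₂ lam β γ).IsFlipSteadyState N T_L T_R ε (μ N T_L T_R)) →
        ∀ T : ℝ, 0 < T → ∀ D : ℕ → ℝ,
          (∀ N : ℕ, Filter.Tendsto (fun δ : ℝ =>
            (Literature.MathematicalPhysics.KineticTheory.HeatConduction.pinnedChain
                ω₂ lam β γ).totalCurrent (μ N (T + δ / 2) (T - δ / 2)) / δ)
            (nhdsWithin 0 {(0 : ℝ)}ᶜ) (nhds (D N))) →
          ∃ s : ℝ, 0 < s ∧ Filter.Tendsto D Filter.atTop (nhds s))) :
    ∀ ω₂ lam β γ : ℝ, 0 < ω₂ → 0 < lam → 0 < β → 0 < γ → ∀ ε : ℝ, 0 < ε →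
      (Literature.MathematicalPhysics.KineticTheory.HeatConduction.pinnedChain
          ω₂ lam β γ).FlipFouriersLawFor ε := by
  intro ω₂ lam β γ hω hl hβ hγ ε hε
  refine flipFouriersLawFor_of_canonical (pinnedChain ω₂ lam β γ) ε
    (hEU ω₂ lam β γ hω hl hβ hγ ε hε) fun μ hμ T hT => ?_
  have huniq := uniq_of_existsUnique (hEU ω₂ lam β γ hω hl hβ hγ ε hε)
  have hDex := hFR ω₂ lam β γ hω hl hβ hγ ε hε huniq μ hμ T hT
  choose D hD using hDex
  obtain ⟨s, hs0, hDs⟩ := hL ω₂ lam β γ hω hl hβ hγ ε hε huniq μ hμ T hT D hD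
  exact ⟨s, hs0, D, hD, hDs⟩

/-- **`NoisyFourier` from a positive response limit (the minimal closing form).** If, for all admissible
parameters and every `ε > 0`, under uniqueness of flip steady states and along every flip-steady family, for
every `T > 0` the response coefficients `D_N` converge to a POSITIVE limit, then the crux holds: clause (i)
(`flipNessExistsUnique`) and the fixed-`N` response (`stub_flipFiniteResponse`) are landed theorems. This is the
weakest statement that closes the crux on top of the landed fixed-`N` theory. -/
theorem noisyFourier_of_responseLimit : (∀ ω₂ lam β γ : ℝ, 0 < ω₂ → 0 < lam → 0 < β → 0 < γ → ∀ ε : ℝ, 0 < ε → (∀ (N : ℕ) (T_L T_R : ℝ), 0 < T_L → 0 < T_R → ∀ μ ν : MeasureTheory.Measure (Literature.MathematicalPhysics.KineticTheory.HeatConduction.PhaseSpace N), (Literature.MathematicalPhysics.KineticTheory.HeatConduction.pinnedChain ω₂ lam β γ).IsFlipSteadyState N T_L T_R ε μ → (Literature.MathematicalPhysics.KineticTheory.HeatConduction.pinnedChain ω₂ lam β γ).IsFlipSteadyState N T_L T_R ε ν → μ = ν) → ∀ μ : (N : ℕ) → ℝ → ℝ → MeasureTheory.Measure (Literature.MathematicalPhysics.KineticTheory.HeatConduction.PhaseSpace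 N), (∀ (N : ℕ) (T_L T_R : ℝ), 0 < T_L → 0 < T_R → (Literature.MathematicalPhysics.KineticTheory.HeatConduction.pinnedChain ω₂ lam β γ).IsFlipSteadyState N T_L T_R ε (μ N T_L T_R)) → ∀ T : ℝ, 0 < T → ∀ D : ℕ → ℝ, (∀ N : ℕ, Filter.Tendsto (fun δ : ℝ => (Literature.MathematicalPhysics.KineticTheory.HeatConduction.pinnedChain ω₂ lam β γ).totalCurrent (μ N (T + δ / 2) (T - δ / 2)) / δ) (nhdsWithin 0 {(0 : ℝ)}ᶜ) (nhds (D N))) → ∃ s : ℝ, 0 < s ∧ Filter.Tendsto D Filter.atTop (nhds s)) → Summit.AtomisticToContinuum.FouriersLaw.Theses.VanishingNoiseTransfer.NoisyFourier :=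
  fun hL =>
  noisyFourier_iff_flipFouriersLawFor.2
    (flipFouriersLawFor_of_responseLimit
      (existsUnique_of_exists_of_unique SectorDirichletGluing.stub_flipNessExists SectorDirichletGluing.flipNessUnique)
      SectorDirichletGluing.stub_flipFiniteResponse hL)

/-! ## The crux from exact monotonicity of the response sequence -/

/-- **`NoisyFourier` from eventually monotone responses.** If, for all admissible parameters and every `ε > 0`,
under uniqueness and along every flip-steady family, for every `T > 0` the response coefficients satisfy
`D_N ≤ D_{N+1}` for all `N ≥ N₀` (some `N₀ ≥ 2`), then the crux holds: the landed ceiling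
(`stub_flipConductanceCeiling`) makes the sequence converge and the landed positivity
(`stub_flipPositiveConductance`, `D_{N₀} > 0`) makes the limit positive (`tendsto_pos_of_monotone_of_bdd`). -/
theorem noisyFourier_of_monotoneResponse : (∀ ω₂ lam β γ : ℝ, 0 < ω₂ → 0 < lam → 0 < β → 0 < γ → ∀ ε : ℝ, 0 < ε → (∀ (N : ℕ) (T_L T_R : ℝ), 0 < T_L → 0 < T_R → ∀ μ ν : MeasureTheory.Measure (Literature.MathematicalPhysics.KineticTheory.HeatConduction.PhaseSpace N), (Literature.MathematicalPhysics.KineticTheory.HeatConduction.pinnedChain ω₂ lam β γ).IsFlipSteadyState N T_L T_R ε μ → (Literature.MathematicalPhysics.KineticTheory.HeatConduction.pinnedChain ω₂ lam β γ).IsFlipSteadyState N T_L T_R ε ν → μ = ν) → ∀ μ : (N : ℕ) → ℝ → ℝ → MeasureTheory.Measure (Literature.MathematicalPhysics.KineticTheory.HeatConduction.PhaseSpace N), (∀ (N : ℕ) (T_L T_R : ℝ), 0 < T_L → 0 < T_R → (Literature.MathematicalPhysics.KineticTheory.HeatConduction.pinnedChain ω₂ lam β γ).IsFlipSteadyState N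 T_L T_R ε (μ N T_L T_R)) → ∀ T : ℝ, 0 < T → ∀ D : ℕ → ℝ, (∀ N : ℕ, Filter.Tendsto (fun δ : ℝ => (Literature.MathematicalPhysics.KineticTheory.HeatConduction.pinnedChain ω₂ lam β γ).totalCurrent (μ N (T + δ / 2) (T - δ / 2)) / δ) (nhdsWithin 0 {(0 : ℝ)}ᶜ) (nhds (D N))) → ∃ N₀ : ℕ, 2 ≤ N₀ ∧ ∀ N : ℕ, N₀ ≤ N → D N ≤ D (N + 1)) → Summit.AtomisticToContinuum.FouriersLaw.Theses.VanishingNoiseTransfer.NoisyFourier :=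
  fun hM =>
  noisyFourier_of_responseLimit fun ω₂ lam β γ hω hl hβ hγ ε hε huniq μ hμ T hT D hD => by
    have hpos : ∀ N : ℕ, 2 ≤ N → 0 < D N :=
      SectorDirichletGluing.stub_flipPositiveConductance ω₂ lam β γ hω hl hβ hγ ε hε huniq μ hμ T hT D hD
    obtain ⟨K, hK⟩ :=
      SectorDirichletGluing.stub_flipConductanceCeiling ω₂ lam β γ hω hl hβ hγ ε hε huniq μ hμ T hT D hD
    obtain ⟨N₀, hN₀, hmono⟩ := hM ω₂ lam β γ hω hl hβ hγ ε hε huniq μ hμ T hT D hD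
    exact tendsto_pos_of_monotone_of_bdd hN₀ hmono hK (hpos N₀ hN₀)

/-! ## The crux from the dual series law and a uniform conductance floor -/

/-- **`NoisyFourier` from quasi-SUPERadditive resistances and an `N`-uniform conductance floor.** If, for
all admissible parameters and every `ε > 0`, under uniqueness and along every flip-steady family, for every
`T > 0` and response coefficients `D` that are positive for `N ≥ 2`: (a) the resistances `R_N = (N−1)/D_N`
satisfy `R_N + R_M ≤ R_{N+M} + C` (`N, M ≥ 2`; the Dirichlet / even-corrector side of the card — a trial
corrector of the long chain glued from the two short ones bounds its CONDUCTANCE from above), and (b) there is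
`d > 0` with `d ≤ D_N` for all `N ≥ 2` (an `N`-uniform conductance floor, the flip twin of
`JunctionLocality.ConductanceLowerBound`; Thomson side, ONE global witness per `N`), then the crux holds
(`tendsto_pos_of_superGluing_of_floor_of_bdd` with the landed ceiling). Together with
`noisyFourier_of_resistanceGluing` (p124321: the SUBadditive series law + the landed ceiling) this exhausts
the two Fekete decompositions of clause (ii). -/
theorem noisyFourier_of_superadditiveResistance_of_floor : (∀ ω₂ lam β γ : ℝ, 0 < ω₂ → 0 < lam → 0 < β → 0 < γ → ∀ ε : ℝ, 0 < ε → (∀ (N : ℕ) (T_L T_R : ℝ), 0 < T_L → 0 < T_R → ∀ μ ν : MeasureTheory.Measure (Literature.MathematicalPhysics.KineticTheory.HeatConduction.PhaseSpace N), (Literature.MathematicalPhysics.KineticTheory.HeatConduction.pinnedChain ω₂ lam β γ).IsFlipSteadyState N T_L T_R ε μ → (Literature.MathematicalPhysics.KineticTheory.HeatConduction.pinnedChain ω₂ lam β γ).IsFlipSteadyState N T_L T_R ε ν → μ = ν) → ∀ μ : (N : ℕ) → ℝ → ℝ → MeasureTheory.Measure (Literature.MathematicalPhysics.KineticTheory.HeatConduction.PhaseSpace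 N), (∀ (N : ℕ) (T_L T_R : ℝ), 0 < T_L → 0 < T_R → (Literature.MathematicalPhysics.KineticTheory.HeatConduction.pinnedChain ω₂ lam β γ).IsFlipSteadyState N T_L T_R ε (μ N T_L T_R)) → ∀ T : ℝ, 0 < T → ∀ D : ℕ → ℝ, (∀ N : ℕ, Filter.Tendsto (fun δ : ℝ => (Literature.MathematicalPhysics.KineticTheory.HeatConduction.pinnedChain ω₂ lam β γ).totalCurrent (μ N (T + δ / 2) (T - δ / 2)) / δ) (nhdsWithin 0 {(0 : ℝ)}ᶜ) (nhds (D N))) → (∀ N : ℕ, 2 ≤ N → 0 < D N) → ∃ C : ℝ, ∀ N M : ℕ, 2 ≤ N → 2 ≤ M → ((N : ℝ) - 1) / D N + ((M : ℝ) - 1) / D M ≤ (((N + M : ℕ) : ℝ) - 1) / D (N + M) + C) → (∀ ω₂ lam β γ : ℝ, 0 < ω₂ → 0 < lam → 0 < β → 0 < γ → ∀ ε : ℝ, 0 < ε → (∀ (N : ℕ) (T_L T_R : ℝ), 0 < T_L → 0 < T_R → ∀ μ ν : MeasureTheory.Measure (Literature.MathematicalPhysics.KineticTheory.HeatConduction.PhaseSpace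 N), (Literature.MathematicalPhysics.KineticTheory.HeatConduction.pinnedChain ω₂ lam β γ).IsFlipSteadyState N T_L T_R ε μ → (Literature.MathematicalPhysics.KineticTheory.HeatConduction.pinnedChain ω₂ lam β γ).IsFlipSteadyState N T_L T_R ε ν → μ = ν) → ∀ μ : (N : ℕ) → ℝ → ℝ → MeasureTheory.Measure (Literature.MathematicalPhysics.KineticTheory.HeatConduction.PhaseSpace N), (∀ (N : ℕ) (T_L T_R : ℝ), 0 < T_L → 0 < T_R → (Literature.MathematicalPhysics.KineticTheory.HeatConduction.pinnedChain ω₂ lam β γ).IsFlipSteadyState N T_L T_R ε (μ N T_L T_R)) → ∀ T : ℝ, 0 < T → ∀ D : ℕ → ℝ, (∀ N : ℕ, Filter.Tendsto (fun δ : ℝ => (Literature.MathematicalPhysics.KineticTheory.HeatConduction.pinnedChain ω₂ lam β γ).totalCurrent (μ N (T + δ / 2) (T - δ / 2)) / δ) (nhdsWithin 0 {(0 : ℝ)}ᶜ) (nhds (D N))) → ∃ d : ℝ, 0 < d ∧ ∀ N : ℕ, 2 ≤ N → d ≤ D N) → Summit.AtomisticToContinuum.FouriersLaw.Theses.VanishingNoiseTransfer.NoisyFourier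 :=
  fun hR hF =>
  noisyFourier_of_responseLimit fun ω₂ lam β γ hω hl hβ hγ ε hε huniq μ hμ T hT D hD => by
    have hpos : ∀ N : ℕ, 2 ≤ N → 0 < D N :=
      SectorDirichletGluing.stub_flipPositiveConductance ω₂ lam β γ hω hl hβ hγ ε hε huniq μ hμ T hT D hD
    obtain ⟨K, hK⟩ :=
      SectorDirichletGluing.stub_flipConductanceCeiling ω₂ lam β γ hω hl hβ hγ ε hε huniq μ hμ T hT D hD
    obtain ⟨C, hC⟩ := hR ω₂ lam β γ hω hl hβ hγ ε hε huniq μ hμ T hT D hD hpos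
    obtain ⟨d, hd, hdD⟩ := hF ω₂ lam β γ hω hl hβ hγ ε hε huniq μ hμ T hT D hD
    exact tendsto_pos_of_superGluing_of_floor_of_bdd hd hdD hK hC

end Summit.AtomisticToContinuum.FouriersLaw.Theorems.NoisyFourier.LineAssembly

end
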